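import Literature.Analysis.ValidatedNumerics.FixedPointInterval
import Literature.NumberTheory.LFunctions.EulerMaclaurinZeta
import Literature.Analysis.Complex.WindingCertificate
import Literature.NumberTheory.LFunctions.LevinsonMontgomery
import Mathlib.Analysis.Complex.RealDeriv
import HarnessLib

/-!
# Certified low-height zero-freeness of `ζ` and `ζ'`: enclosures and the certificate checker

Trunk T-ANT (NumberTheory/LFunctions). The arithmetic half of the certified low-height
computations in the Levinson–Montgomery route to Speiser's theorem (`Literature.NumberTheory.LFunctions.speiser_iff`,
`RHClassicalEquivalents.lean`; Levinson–Montgomery's Theorem 1 (1.2) uses `ζ ≠ 0` on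
`(0,½) × (0, 10.5]` and `ζ' ≠ 0` on `(0,½) × (0,10]`, classically Gram 1903 and Spira 1965).

**Part 1 — enclosures.** Kernel-evaluable enclosures, in the fixed-point interval arithmetic of
`Literature/Analysis/ValidatedNumerics/FixedPointInterval.lean`, of the order-two Euler–Maclaurin
main terms `emMain 6 s`, `emMain₁ 6 s`, `emMain₂ 6 s` of `EulerMaclaurinZeta.lean` (Edwards,
*Riemann's Zeta Function*, §6.4) over a complex box `B ∋ s`, with scaled upper bounds for the
remainders `‖emRem₂ 6 s‖`, `‖emRem₂D 6 s‖`, `‖emRem₂DD 6 s‖` on boxes with `Re s ≥ 0`, whence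
enclosures of `ζ(s)`, `ζ'(s)`, `ζ''(s)` (`riemannZeta_eq_emMain_add_emRem₂`,
`deriv_riemannZeta_eq_eulerMaclaurin₂`, `deriv2_riemannZeta_eq_eulerMaclaurin₂`). The logarithms
`log 2, …, log 7` are literal intervals validated once by the kernel (`checkLogs_eq_true`).

**Part 2 — the checker.** A kernel-checkable test `certCheck k C : Bool` for a certificate `C`
(lists of pieces with quadrant labels along the boundary of `[0, ½] × [T₀, T]`,
`T₀ = C.bot / 2^48`, `T = C.top / 2^48`) and its soundness: `certCheck k C = true` implies that
`ζ` (`k = 0`) resp. `ζ'` (`k = 1`) has no zero in `(0, ½) × (T₀, T]`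
(`riemannZeta_ne_zero_of_certCheck`, `deriv_riemannZeta_ne_zero_of_certCheck`), through the
winding-number certificate theorem `Literature.Analysis.Complex.no_zero_of_winding_certificate`
(`Literature/Analysis/Complex/WindingCertificate.lean`). On each piece `[z₀, z₀ + h u]` (`u = 1`
or `i`) with label `d` the test verifies, from a point enclosure of `f(z₀)` and a box enclosure of
`f'` on the piece, the mean-value inequality
`lo Re(c f(z₀)) - R₀ + min(0, h · (lo Re(c u f') - R₁)) > 0` (`c = (-i)^d`), which gives
`Re (c f) > 0` on the whole piece by the real mean value theorem applied to
`τ ↦ Re (c f(z₀ + τ u))`. The certificates themselves (and the `decide +kernel` calls) are the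
files `ZetaLowHeightZeros/*.lean`.

Everything is proved; the only computation in this file is `decide +kernel` on the closed integer
term `checkLogs`.

## Main definitions and results (namespace `Literature.RH.ZetaNum`)

* `LOG2 … LOG7`, `checkLogs`, `mem_LOG2 … mem_LOG7`; `cpowNegBox ℓ B ∋ n^{-s}` (`mem_cpowNegBox`);
  `emABox`, `emA₁Box`, `emA₂Box`; `ZetaEncl`, `zetaEncl B`, `zetaEncl_spec`;
  `zeta_mem`, `deriv_zeta_mem`, `deriv2_zeta_mem` (`ζ(s) = m + r`, `m ∈ M0`, `‖r‖·2^48 ≤ R0`, …).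
* `qrotBox`, `pieceCheck`, `hEdgeCheck`, `vEdgeCheck`, `Cert`, `certCheck`;
  `pos_of_deriv_bound` (the mean-value inequality); `hEdgeCheck_sound`, `vEdgeCheck_sound`
  (checked edges are valid `Literature.Analysis.Complex.HPieces` / `VPieces`); `Fk_ne_zero_of_certCheck`,
  `riemannZeta_ne_zero_of_certCheck`, `deriv_riemannZeta_ne_zero_of_certCheck`.

## References

* H. M. Edwards, *Riemann's Zeta Function*, Academic Press 1974, §6.4.
* R. E. Moore, *Interval Analysis*, Prentice-Hall 1966 (inclusion property, mean value form).
  [folklore]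
-/

open Complex Set Literature.Analysis.ValidatedNumerics.Numerics Literature.Analysis.Complex

namespace Literature.NumberTheory.LFunctions.ZetaNum

/-! ### The logarithms of `2, 3, 4, 5, 6, 7` -/

/-- Literal enclosure of `log 2` (validated by `checkLogs`). [folklore] -/
def LOG2 : FI := ⟨195103586505140, 195103586505200⟩
/-- Literal enclosure of `log 3`. [folklore] -/
def LOG3 : FI := ⟨309231868366850, 309231868366970⟩
/-- Enclosure of `log 4 = 2 log 2`. [folklore] -/
def LOG4 : FI := LOG2.mulInt 2
/-- Literal enclosure of `log 5`. [folklore] -/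
def LOG5 : FI := ⟨453016498919560, 453016498919730⟩
/-- Enclosure of `log 6 = log 2 + log 3`. [folklore] -/
def LOG6 : FI := LOG2.add LOG3
/-- Literal enclosure of `log 7`. [folklore] -/
def LOG7 : FI := ⟨547725013886260, 547725013886500⟩

/-- `X ⊆ Y` on endpoints. [folklore] -/
def incl (X Y : FI) : Bool := decide (Y.lo ≤ X.lo) && decide (X.hi ≤ Y.hi)

/-- [folklore] -/
lemma mem_of_incl {x : ℝ} {X Y : FI} (h : incl X Y = true) (hx : FI.mem x X) : FI.mem x Y := by
  simp only [incl, Bool.and_eq_true, decide_eq_true_eq] at h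
  exact ⟨le_trans (by exact_mod_cast h.1) hx.1, le_trans hx.2 (by exact_mod_cast h.2)⟩

/-- The one-time validation of the logarithm literals from the series for `log (1 - x)` at
`x = 1/2, 1/3, 1/5, 1/8`. [folklore] -/
def checkLogs : Bool :=
  match FI.logOneSub (FI.ofFrac 1 2) 52, FI.logOneSub (FI.ofFrac 1 3) 36,
    FI.logOneSub (FI.ofFrac 1 5) 26, FI.logOneSub (FI.ofFrac 1 8) 20 with
  | some a, some b, some c, some d =>
      incl a.neg LOG2 && incl (LOG2.sub b) LOG3 && incl ((LOG2.mulInt 2).sub c) LOG5 &&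
        incl ((LOG2.mulInt 3).add d) LOG7
  | _, _, _, _ => false

/-- The kernel validates the logarithm literals. [folklore] -/
theorem checkLogs_eq_true : checkLogs = true := by decide +kernel

/-- `log 2 ∈ LOG2`. [folklore] -/
theorem mem_LOG2 : FI.mem (Real.log 2) LOG2 := by
  have h := checkLogs_eq_true
  unfold checkLogs at h
  split at h
  · rename_i a b c d ha hb hc hd
    simp only [Bool.and_eq_true] at h
    have := FI.mem_logOneSub ha (FI.mem_ofFrac 1 (by norm_num))
    have e : Real.log 2 = -Real.log (1 - (1 : ℤ) / (2 : ℕ)) := by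
      rw [show (1 : ℝ) - (1 : ℤ) / (2 : ℕ) = 2⁻¹ by norm_num, Real.log_inv, neg_neg]
    rw [e]
    exact mem_of_incl h.1.1.1 (FI.mem_neg this)
  · simp at h

/-- `log 3 ∈ LOG3`. [folklore] -/
theorem mem_LOG3 : FI.mem (Real.log 3) LOG3 := by
  have h := checkLogs_eq_true
  unfold checkLogs at h
  split at h
  · rename_i a b c d ha hb hc hd
    simp only [Bool.and_eq_true] at h
    have := FI.mem_logOneSub hb (FI.mem_ofFrac 1 (by norm_num))
    have e : Real.log 3 = Real.log 2 - Real.log (1 - (1 : ℤ) / (3 : ℕ)) := by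
      rw [show (1 : ℝ) - (1 : ℤ) / (3 : ℕ) = 2 / 3 by norm_num,
        Real.log_div (by norm_num) (by norm_num)]
      ring
    rw [e]
    exact mem_of_incl h.1.1.2 (FI.mem_sub mem_LOG2 this)
  · simp at h

/-- `log 4 ∈ LOG4`. [folklore] -/
theorem mem_LOG4 : FI.mem (Real.log 4) LOG4 := by
  have : Real.log 4 = Real.log 2 * (2 : ℤ) := by
    rw [show (4 : ℝ) = 2 ^ 2 by norm_num, Real.log_pow]; push_cast; ring
  rw [this]; exact FI.mem_mulInt mem_LOG2 2

/-- `log 5 ∈ LOG5`. [folklore] -/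
theorem mem_LOG5 : FI.mem (Real.log 5) LOG5 := by
  have h := checkLogs_eq_true
  unfold checkLogs at h
  split at h
  · rename_i a b c d ha hb hc hd
    simp only [Bool.and_eq_true] at h
    have := FI.mem_logOneSub hc (FI.mem_ofFrac 1 (by norm_num))
    have e : Real.log 5 = Real.log 2 * (2 : ℤ) - Real.log (1 - (1 : ℤ) / (5 : ℕ)) := by
      rw [show (1 : ℝ) - (1 : ℤ) / (5 : ℕ) = 4 / 5 by norm_num,
        Real.log_div (by norm_num) (by norm_num), show (4 : ℝ) = 2 ^ 2 by norm_num, Real.log_pow]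
      push_cast; ring
    rw [e]
    exact mem_of_incl h.1.2 (FI.mem_sub (FI.mem_mulInt mem_LOG2 2) this)
  · simp at h

/-- `log 6 ∈ LOG6`. [folklore] -/
theorem mem_LOG6 : FI.mem (Real.log 6) LOG6 := by
  have : Real.log 6 = Real.log 2 + Real.log 3 := by
    rw [show (6 : ℝ) = 2 * 3 by norm_num, Real.log_mul (by norm_num) (by norm_num)]
  rw [this]; exact FI.mem_add mem_LOG2 mem_LOG3

/-- `log 7 ∈ LOG7`. [folklore] -/
theorem mem_LOG7 : FI.mem (Real.log 7) LOG7 := by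
  have h := checkLogs_eq_true
  unfold checkLogs at h
  split at h
  · rename_i a b c d ha hb hc hd
    simp only [Bool.and_eq_true] at h
    have := FI.mem_logOneSub hd (FI.mem_ofFrac 1 (by norm_num))
    have e : Real.log 7 = Real.log 2 * (3 : ℤ) + Real.log (1 - (1 : ℤ) / (8 : ℕ)) := by
      rw [show (1 : ℝ) - (1 : ℤ) / (8 : ℕ) = 7 / 8 by norm_num,
        Real.log_div (by norm_num) (by norm_num), show (8 : ℝ) = 2 ^ 3 by norm_num, Real.log_pow]
      push_cast; ring
    rw [e]
    exact mem_of_incl h.2 (FI.mem_add (FI.mem_mulInt mem_LOG2 3) this)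
  · simp at h

/-! ### `n^{-s}` -/

/-- Enclosure of `n^{-s} = e^{-σ log n} · \overline{e^{i t log n}}` for `s = σ + it ∈ B`, given
`ℓ ∋ log n` (`none` unless `|σ log n| ≤ 1`). [folklore] -/
def cpowNegBox (ℓ : FI) (B : CB) : Option CB :=
  match FI.expSmall (B.re.mul ℓ).neg, CB.expI (B.im.mul ℓ) with
  | some E, some R => some ((CB.conj R).mulFI E)
  | _, _ => none

/-- [folklore] -/
theorem mem_cpowNegBox {n : ℕ} (hn : 0 < n) {ℓ : FI} (hℓ : FI.mem (Real.log n) ℓ) {B P : CB}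
    {s : ℂ} (hs : CB.mem s B) (h : cpowNegBox ℓ B = some P) : CB.mem ((n : ℂ) ^ (-s)) P := by
  unfold cpowNegBox at h
  split at h
  · rename_i E R hE hR
    simp only [Option.some.injEq] at h
    subst h
    have hE' := FI.mem_expSmall hE (FI.mem_neg (FI.mem_mul hs.1 hℓ))
    have hR' := CB.mem_conj (CB.mem_expI hR (FI.mem_mul hs.2 hℓ))
    have key : (n : ℂ) ^ (-s) =
        starRingEnd ℂ (Complex.exp ((s.im * Real.log n : ℝ) * I)) *
          (Real.exp (-(s.re * Real.log n)) : ℝ) := by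
      have hn0 : (n : ℂ) ≠ 0 := by exact_mod_cast hn.ne'
      rw [cpow_def_of_ne_zero hn0, ← Complex.natCast_log, ← Complex.exp_conj, Complex.ofReal_exp,
        ← Complex.exp_add]
      congr 1
      apply Complex.ext <;>
        simp only [mul_re, mul_im, neg_re, neg_im, add_re, add_im, Complex.ofReal_re,
          Complex.ofReal_im, Complex.I_re, Complex.I_im, Complex.conj_re, Complex.conj_im,
          mul_zero, mul_one, zero_mul, sub_zero, add_zero, zero_add] <;> ring
    rw [key]
    exact CB.mem_mulFI hR' hE'
  · simp at h

/-! ### The rational functions `A`, `A'`, `A''` of the main term (`N = 6`) -/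

/-- Enclosure of `emA 6 s = 6/(s-1) + 1/2 + s/72 - s(s+1)(s+2)/155520`. [folklore] -/
def emABox (B : CB) : Option CB :=
  match CB.divBox (CB.ofInt 6) (B.sub (CB.ofInt 1)) with
  | some q =>
      some (((q.add (CB.ofFI (FI.ofFrac 1 2))).add (B.divNat 72)).sub
        (((B.mul (B.add (CB.ofInt 1))).mul (B.add (CB.ofInt 2))).divNat 155520))
  | none => none

/-- Enclosure of `emA₁ 6 s = -6/(s-1)² + 1/72 - (3s²+6s+2)/155520`. [folklore] -/
def emA₁Box (B : CB) : Option CB :=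
  match CB.divBox (CB.ofInt 6) ((B.sub (CB.ofInt 1)).sqr) with
  | some q =>
      some (((q.neg).add (CB.ofFI (FI.ofFrac 1 72))).sub
        (((((B.sqr).mulInt 3).add (B.mulInt 6)).add (CB.ofInt 2)).divNat 155520))
  | none => none

/-- Enclosure of `emA₂ 6 s = 12/(s-1)³ - (6s+6)/155520`. [folklore] -/
def emA₂Box (B : CB) : Option CB :=
  match CB.divBox (CB.ofInt 12) ((B.sub (CB.ofInt 1)).mul ((B.sub (CB.ofInt 1)).sqr)) with
  | some q => some (q.sub (((B.mulInt 6).add (CB.ofInt 6)).divNat 155520))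
  | none => none

variable {s : ℂ} {B : CB}

/-- [folklore] -/
theorem mem_emABox {Q : CB} (h : emABox B = some Q) (hs : CB.mem s B) : CB.mem (emA 6 s) Q := by
  unfold emABox at h
  split at h
  · rename_i q hq
    simp only [Option.some.injEq] at h
    subst h
    have h1 := CB.mem_divBox hq (CB.mem_ofInt 6) (CB.mem_sub hs (CB.mem_ofInt 1))
    have h2 := CB.mem_ofFI (FI.mem_ofFrac 1 (q := 2) (by norm_num))
    have h3 := CB.mem_divNat hs (n := 72) (by norm_num)
    have h4 := CB.mem_divNat (CB.mem_mul (CB.mem_mul hs (CB.mem_add hs (CB.mem_ofInt 1)))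
      (CB.mem_add hs (CB.mem_ofInt 2))) (n := 155520) (by norm_num)
    have := CB.mem_sub (CB.mem_add (CB.mem_add h1 h2) h3) h4
    convert this using 1
    simp only [emA]; push_cast; ring
  · simp at h

/-- [folklore] -/
theorem mem_emA₁Box {Q : CB} (h : emA₁Box B = some Q) (hs : CB.mem s B) :
    CB.mem (emA₁ 6 s) Q := by
  unfold emA₁Box at h
  split at h
  · rename_i q hq
    simp only [Option.some.injEq] at h
    subst h
    have h1 := CB.mem_divBox hq (CB.mem_ofInt 6) (CB.mem_sqr (CB.mem_sub hs (CB.mem_ofInt 1)))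
    have h2 := CB.mem_ofFI (FI.mem_ofFrac 1 (q := 72) (by norm_num))
    have h4 := CB.mem_divNat (CB.mem_add (CB.mem_add (CB.mem_mulInt (CB.mem_sqr hs) 3)
      (CB.mem_mulInt hs 6)) (CB.mem_ofInt 2)) (n := 155520) (by norm_num)
    have := CB.mem_sub (CB.mem_add (CB.mem_neg h1) h2) h4
    convert this using 1
    simp only [emA₁]; push_cast; ring
  · simp at h

/-- [folklore] -/
theorem mem_emA₂Box {Q : CB} (h : emA₂Box B = some Q) (hs : CB.mem s B) :
    CB.mem (emA₂ 6 s) Q := by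
  unfold emA₂Box at h
  split at h
  · rename_i q hq
    simp only [Option.some.injEq] at h
    subst h
    have h1 := CB.mem_divBox hq (CB.mem_ofInt 12) (CB.mem_mul (CB.mem_sub hs (CB.mem_ofInt 1))
      (CB.mem_sqr (CB.mem_sub hs (CB.mem_ofInt 1))))
    have h4 := CB.mem_divNat (CB.mem_add (CB.mem_mulInt hs 6) (CB.mem_ofInt 6))
      (n := 155520) (by norm_num)
    have := CB.mem_sub h1 h4
    convert this using 1
    simp only [emA₂]; push_cast; ring
  · simp at h

/-! ### The main terms and the remainder radii -/

/-- The data produced for a box `B`: enclosures of the three main terms and scaled upper bounds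
of the three remainders. [folklore] -/
structure ZetaEncl where
  /-- encloses `emMain 6 s` -/
  M0 : CB
  /-- encloses `emMain₁ 6 s` -/
  M1 : CB
  /-- encloses `emMain₂ 6 s` -/
  M2 : CB
  /-- `‖emRem₂ 6 s‖ · 2^48 ≤ R0` -/
  R0 : ℤ
  /-- `‖emRem₂D 6 s‖ · 2^48 ≤ R1` -/
  R1 : ℤ
  /-- `‖emRem₂DD 6 s‖ · 2^48 ≤ R2` -/
  R2 : ℤ

/-- An upper bound of `‖z‖ · 2^48` on a box (the `ℓ¹` bound `|Re| + |Im|`, cheap for the kernel).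
[folklore] -/
def normHi (A : CB) : ℤ := A.re.absHi + A.im.absHi

/-- [folklore] -/
lemma norm_le_normHi {z : ℂ} {A : CB} (hz : CB.mem z A) : ‖z‖ * SC ≤ (normHi A : ℝ) := by
  have := CB.norm_le_absHi hz
  simpa [normHi] using this

/-- The constant `7 / (96 · 120 · 6⁴)` of the remainder bounds. [folklore] -/
def remC : FI := FI.ofFrac 7 14929920

/-- Box of `(s)₅ = s(s+1)(s+2)(s+3)(s+4)`. [folklore] -/
def poch5Box (B : CB) : CB :=
  (((B.mul (B.add (CB.ofInt 1))).mul (B.add (CB.ofInt 2))).mul (B.add (CB.ofInt 3))).mul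
    (B.add (CB.ofInt 4))

/-- Box of `(s)₅' = 5s⁴ + 40s³ + 105s² + 100s + 24` (Horner). [folklore] -/
def poch5₁Box (B : CB) : CB :=
  ((((((B.mulInt 5).add (CB.ofInt 40)).mul B).add (CB.ofInt 105)).mul B).add (CB.ofInt 100)).mul B
    |>.add (CB.ofInt 24)

/-- Box of `(s)₅'' = 20s³ + 120s² + 210s + 100` (Horner). [folklore] -/
def poch5₂Box (B : CB) : CB :=
  ((((B.mulInt 20).add (CB.ofInt 120)).mul B).add (CB.ofInt 210)).mul B |>.add (CB.ofInt 100)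

/-- `log 6 / 4 + 1/16`. [folklore] -/
def gFI : FI := (LOG6.divNat 4).add (FI.ofFrac 1 16)

/-- `log² 6 / 4 + log 6 / 8 + 1/32`. [folklore] -/
def g2FI : FI := ((LOG6.sqr.divNat 4).add (LOG6.divNat 8)).add (FI.ofFrac 1 32)

/-- Interval containing the bound `‖(s)₅‖/4 · c` of `‖R₄‖`. [folklore] -/
def r0FI (B : CB) : FI := ((⟨0, normHi (poch5Box B)⟩ : FI).divNat 4).mul remC

/-- Interval containing the bound of `‖R₄'‖`. [folklore] -/
def r1FI (B : CB) : FI :=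
  (((⟨0, normHi (poch5₁Box B)⟩ : FI).divNat 4).add
    ((⟨0, normHi (poch5Box B)⟩ : FI).mul gFI)).mul remC

/-- Interval containing the bound of `‖R₄''‖`. [folklore] -/
def r2FI (B : CB) : FI :=
  ((((⟨0, normHi (poch5₂Box B)⟩ : FI).divNat 4).add
    (((⟨0, normHi (poch5₁Box B)⟩ : FI).mulInt 2).mul gFI)).add
    ((⟨0, normHi (poch5Box B)⟩ : FI).mul g2FI)).mul remC

/-- The remainder radii (scaled upper bounds of `‖R₄‖, ‖R₄'‖, ‖R₄''‖` on the box, valid when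
`Re s ≥ 0`). [folklore] -/
def remRadii (B : CB) : ℤ × ℤ × ℤ := ((r0FI B).hi, (r1FI B).hi, (r2FI B).hi)

/-- The enclosure data for `ζ, ζ', ζ''` on a box `B` (`none` if a precondition of the interval
operations fails). [folklore] -/
def zetaEncl (B : CB) : Option ZetaEncl :=
  (cpowNegBox LOG2 B).bind fun p2 ↦
  (cpowNegBox LOG3 B).bind fun p3 ↦
  (cpowNegBox LOG4 B).bind fun p4 ↦
  (cpowNegBox LOG5 B).bind fun p5 ↦
  (cpowNegBox LOG6 B).bind fun p6 ↦
  (emABox B).bind fun A ↦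
  (emA₁Box B).bind fun A1 ↦
  (emA₂Box B).bind fun A2 ↦
    let sum0 := (((CB.ofInt 1).add p2).add p3).add p4 |>.add p5
    let sum1 := ((p2.mulFI LOG2).add (p3.mulFI LOG3)).add (p4.mulFI LOG4) |>.add (p5.mulFI LOG5)
    let sum2 := ((p2.mulFI LOG2.sqr).add (p3.mulFI LOG3.sqr)).add (p4.mulFI LOG4.sqr) |>.add
      (p5.mulFI LOG5.sqr)
    let M0 := sum0.add (p6.mul A)
    let M1 := (sum1.neg).add (p6.mul (A1.sub (A.mulFI LOG6)))
    let M2 := sum2.add (p6.mul ((A2.sub ((A1.mulFI LOG6).mulInt 2)).add (A.mulFI LOG6.sqr)))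
    let r := remRadii B
    some ⟨M0, M1, M2, r.1, r.2.1, r.2.2⟩

/-! ### Specifications -/

/-- `Σ_{n ∈ [1,6)} f n = f 1 + f 2 + f 3 + f 4 + f 5`. [folklore] -/
lemma sum_Ico_one_six (f : ℕ → ℂ) :
    ∑ n ∈ Finset.Ico 1 6, f n = f 1 + f 2 + f 3 + f 4 + f 5 := by
  rw [Finset.sum_Ico_eq_sum_range]
  simp [Finset.sum_range_succ]

/-- The remainder radii are sound on boxes with `Re s ≥ 0`. [folklore] -/
theorem remRadii_spec (hs : CB.mem s B) (h0 : 0 ≤ B.re.lo) :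
    ‖emRem₂ 6 s‖ * SC ≤ ((remRadii B).1 : ℝ) ∧ ‖emRem₂D 6 s‖ * SC ≤ ((remRadii B).2.1 : ℝ) ∧
      ‖emRem₂DD 6 s‖ * SC ≤ ((remRadii B).2.2 : ℝ) := by
  have hre : 0 ≤ s.re := by
    have := le_trans (show ((0 : ℤ) : ℝ) ≤ B.re.lo by exact_mod_cast h0) hs.1.1
    simp at this; nlinarith [SC_pos]
  have hre' : -4 < s.re := by linarith
  -- the Pochhammer boxes
  have hB1 := CB.mem_add hs (CB.mem_ofInt 1)
  have hP : CB.mem (poch5 s) (poch5Box B) := by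
    have := CB.mem_mul (CB.mem_mul (CB.mem_mul (CB.mem_mul hs hB1)
      (CB.mem_add hs (CB.mem_ofInt 2))) (CB.mem_add hs (CB.mem_ofInt 3)))
      (CB.mem_add hs (CB.mem_ofInt 4))
    unfold poch5Box
    convert this using 1; simp only [poch5]; push_cast; ring
  have hP1 : CB.mem (poch5₁ s) (poch5₁Box B) := by
    have := CB.mem_add (CB.mem_mul (CB.mem_add (CB.mem_mul (CB.mem_add (CB.mem_mul (CB.mem_add
      (CB.mem_mulInt hs 5) (CB.mem_ofInt 40)) hs) (CB.mem_ofInt 105)) hs) (CB.mem_ofInt 100)) hs)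
      (CB.mem_ofInt 24)
    unfold poch5₁Box
    convert this using 1; simp only [poch5₁]; push_cast; ring
  have hP2 : CB.mem (poch5₂ s) (poch5₂Box B) := by
    have := CB.mem_add (CB.mem_mul (CB.mem_add (CB.mem_mul (CB.mem_add (CB.mem_mulInt hs 20)
      (CB.mem_ofInt 120)) hs) (CB.mem_ofInt 210)) hs) (CB.mem_ofInt 100)
    unfold poch5₂Box
    convert this using 1; simp only [poch5₂]; push_cast; ring
  -- norms as members of `[0, normHi]`
  have nmem : ∀ {z : ℂ} {A : CB}, CB.mem z A → FI.mem ‖z‖ ⟨0, normHi A⟩ := fun hz ↦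
    ⟨by simpa using mul_nonneg (norm_nonneg _) SC_pos.le, norm_le_normHi hz⟩
  have n0 := nmem hP
  have n1 := nmem hP1
  have n2 := nmem hP2
  -- constants
  have hC : FI.mem ((7 : ℤ) / (14929920 : ℕ) : ℝ) remC := FI.mem_ofFrac 7 (by norm_num)
  have hg : FI.mem (Real.log 6 / (4 : ℕ) + (1 : ℤ) / (16 : ℕ)) gFI :=
    FI.mem_add (FI.mem_divNat mem_LOG6 (by norm_num)) (FI.mem_ofFrac 1 (by norm_num))
  have hg2 : FI.mem (Real.log 6 ^ 2 / (4 : ℕ) + Real.log 6 / (8 : ℕ) + (1 : ℤ) / (32 : ℕ)) g2FI :=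
    FI.mem_add (FI.mem_add (FI.mem_divNat (FI.mem_sqr mem_LOG6) (by norm_num))
      (FI.mem_divNat mem_LOG6 (by norm_num))) (FI.mem_ofFrac 1 (by norm_num))
  -- the three real bounds, as interval members
  have m0 : FI.mem _ (r0FI B) := FI.mem_mul (FI.mem_divNat n0 (n := 4) (by norm_num)) hC
  have m1 : FI.mem _ (r1FI B) :=
    FI.mem_mul (FI.mem_add (FI.mem_divNat n1 (n := 4) (by norm_num)) (FI.mem_mul n0 hg)) hC
  have m2 : FI.mem _ (r2FI B) := FI.mem_mul (FI.mem_add (FI.mem_add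
    (FI.mem_divNat n2 (n := 4) (by norm_num)) (FI.mem_mul (FI.mem_mulInt n1 2) hg))
    (FI.mem_mul n0 hg2)) hC
  -- elementary estimates: `6^{-(σ+4)} ≤ 6^{-4}`, `1/(σ+4) ≤ 1/4`
  have hpow : (6 : ℝ) ^ (-(s.re + 4)) ≤ 1 / 1296 := by
    rw [show (1 : ℝ) / 1296 = (6 : ℝ) ^ (-(4 : ℝ)) by
      rw [Real.rpow_neg (by norm_num)]; norm_num]
    exact Real.rpow_le_rpow_of_exponent_le (by norm_num) (by linarith)
  have ha1 : 1 / (s.re + 4) ≤ (1 : ℝ) / 4 := by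
    rw [div_le_div_iff₀ (by linarith) (by norm_num)]; linarith
  have ha2 : 1 / (s.re + 4) ^ 2 ≤ (1 : ℝ) / 16 := by
    rw [div_le_div_iff₀ (by positivity) (by norm_num)]; nlinarith
  have ha3 : 2 / (s.re + 4) ^ 3 ≤ (1 : ℝ) / 32 := by
    rw [div_le_div_iff₀ (by positivity) (by norm_num)]; nlinarith
  have hlog6 : 0 ≤ Real.log 6 := Real.log_nonneg (by norm_num)
  have hP0 : 0 ≤ ‖poch5 s‖ := norm_nonneg _
  have hP10 : 0 ≤ ‖poch5₁ s‖ := norm_nonneg _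
  have hP20 : 0 ≤ ‖poch5₂ s‖ := norm_nonneg _
  have hpow0 : 0 ≤ (6 : ℝ) ^ (-(s.re + 4)) := Real.rpow_nonneg (by norm_num) _
  have six : ((6 : ℕ) : ℝ) = 6 := by norm_num
  -- factor bounds
  have T1 : (6 : ℝ) ^ (-(s.re + 4)) / (s.re + 4) ≤ 1 / 1296 * (1 / 4) := by
    rw [div_eq_mul_one_div]
    exact mul_le_mul hpow ha1 (by positivity) (by norm_num)
  have T2 : (6 : ℝ) ^ (-(s.re + 4)) * (Real.log 6 / (s.re + 4) + 1 / (s.re + 4) ^ 2) ≤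
      1 / 1296 * (Real.log 6 / (4 : ℕ) + (1 : ℤ) / (16 : ℕ)) := by
    refine mul_le_mul hpow ?_ (by positivity) (by norm_num)
    push_cast
    refine add_le_add ?_ ha2
    rw [div_eq_mul_one_div, div_eq_mul_one_div (Real.log 6)]
    exact mul_le_mul_of_nonneg_left ha1 hlog6
  have T3 : (6 : ℝ) ^ (-(s.re + 4)) *
      (Real.log 6 ^ 2 / (s.re + 4) + 2 * Real.log 6 / (s.re + 4) ^ 2 + 2 / (s.re + 4) ^ 3) ≤
      1 / 1296 * (Real.log 6 ^ 2 / (4 : ℕ) + Real.log 6 / (8 : ℕ) + (1 : ℤ) / (32 : ℕ)) := by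
    refine mul_le_mul hpow ?_ (by positivity) (by norm_num)
    push_cast
    refine add_le_add (add_le_add ?_ ?_) ha3
    · rw [div_eq_mul_one_div, div_eq_mul_one_div (Real.log 6 ^ 2)]
      exact mul_le_mul_of_nonneg_left ha1 (by positivity)
    · rw [div_eq_mul_one_div, show Real.log 6 / 8 = 2 * Real.log 6 * (1 / 16) by ring]
      exact mul_le_mul_of_nonneg_left ha2 (by positivity)
  have hCpos : (0 : ℝ) ≤ (7 : ℤ) / (14929920 : ℕ) := by norm_num
  refine ⟨?_, ?_, ?_⟩
  · -- `R0`
    have hR := norm_emRem₂_le (N := 6) (by norm_num) hre'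
    rw [six] at hR
    have key : ‖emRem₂ 6 s‖ ≤ ‖poch5 s‖ / (4 : ℕ) * ((7 : ℤ) / (14929920 : ℕ) : ℝ) := by
      refine hR.trans ?_
      have e : ‖poch5 s‖ / 120 * (7 / 96 * ((6 : ℝ) ^ (-(s.re + 4)) / (s.re + 4))) =
          ‖poch5 s‖ * (7 / 11520) * ((6 : ℝ) ^ (-(s.re + 4)) / (s.re + 4)) := by ring
      rw [e]
      have := mul_le_mul_of_nonneg_left T1 (show 0 ≤ ‖poch5 s‖ * (7 / 11520) by positivity)
      refine this.trans (le_of_eq ?_)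
      push_cast; ring
    exact le_trans (mul_le_mul_of_nonneg_right key SC_pos.le) m0.2
  · -- `R1`
    have hR := norm_emRem₂D_le (N := 6) (by norm_num) hre'
    rw [six] at hR
    have key : ‖emRem₂D 6 s‖ ≤ (‖poch5₁ s‖ / (4 : ℕ) + ‖poch5 s‖ *
        (Real.log 6 / (4 : ℕ) + (1 : ℤ) / (16 : ℕ))) * ((7 : ℤ) / (14929920 : ℕ) : ℝ) := by
      refine hR.trans ?_
      have e : ‖poch5₁ s‖ / 120 * (7 / 96 * ((6 : ℝ) ^ (-(s.re + 4)) / (s.re + 4))) +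
          ‖poch5 s‖ / 120 * (7 / 96 * ((6 : ℝ) ^ (-(s.re + 4)) *
            (Real.log 6 / (s.re + 4) + 1 / (s.re + 4) ^ 2))) =
          (‖poch5₁ s‖ * ((6 : ℝ) ^ (-(s.re + 4)) / (s.re + 4)) +
            ‖poch5 s‖ * ((6 : ℝ) ^ (-(s.re + 4)) *
              (Real.log 6 / (s.re + 4) + 1 / (s.re + 4) ^ 2))) * (7 / 11520) := by ring
      rw [e]
      have h1 := mul_le_mul_of_nonneg_left T1 hP10
      have h2 := mul_le_mul_of_nonneg_left T2 hP0
      have := mul_le_mul_of_nonneg_right (add_le_add h1 h2) (show (0 : ℝ) ≤ 7 / 11520 by norm_num)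
      refine this.trans (le_of_eq ?_)
      push_cast; ring
    exact le_trans (mul_le_mul_of_nonneg_right key SC_pos.le) m1.2
  · -- `R2`
    have hR := norm_emRem₂DD_le (N := 6) (by norm_num) hre'
    rw [six] at hR
    have key : ‖emRem₂DD 6 s‖ ≤ (‖poch5₂ s‖ / (4 : ℕ) + ‖poch5₁ s‖ * (2 : ℤ) *
        (Real.log 6 / (4 : ℕ) + (1 : ℤ) / (16 : ℕ)) + ‖poch5 s‖ *
        (Real.log 6 ^ 2 / (4 : ℕ) + Real.log 6 / (8 : ℕ) + (1 : ℤ) / (32 : ℕ))) *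
          ((7 : ℤ) / (14929920 : ℕ) : ℝ) := by
      refine hR.trans ?_
      have e : ‖poch5₂ s‖ / 120 * (7 / 96 * ((6 : ℝ) ^ (-(s.re + 4)) / (s.re + 4))) +
          2 * (‖poch5₁ s‖ / 120) * (7 / 96 * ((6 : ℝ) ^ (-(s.re + 4)) *
            (Real.log 6 / (s.re + 4) + 1 / (s.re + 4) ^ 2))) +
          ‖poch5 s‖ / 120 * (7 / 96 * ((6 : ℝ) ^ (-(s.re + 4)) *
            (Real.log 6 ^ 2 / (s.re + 4) + 2 * Real.log 6 / (s.re + 4) ^ 2 + 2 / (s.re + 4) ^ 3))) =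
          (‖poch5₂ s‖ * ((6 : ℝ) ^ (-(s.re + 4)) / (s.re + 4)) +
            ‖poch5₁ s‖ * 2 * ((6 : ℝ) ^ (-(s.re + 4)) *
              (Real.log 6 / (s.re + 4) + 1 / (s.re + 4) ^ 2)) +
            ‖poch5 s‖ * ((6 : ℝ) ^ (-(s.re + 4)) *
              (Real.log 6 ^ 2 / (s.re + 4) + 2 * Real.log 6 / (s.re + 4) ^ 2 +
                2 / (s.re + 4) ^ 3))) * (7 / 11520) := by ring
      rw [e]
      have h1 := mul_le_mul_of_nonneg_left T1 hP20
      have h2 := mul_le_mul_of_nonneg_left T2 (show 0 ≤ ‖poch5₁ s‖ * 2 by positivity)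
      have h3 := mul_le_mul_of_nonneg_left T3 hP0
      have := mul_le_mul_of_nonneg_right (add_le_add (add_le_add h1 h2) h3)
        (show (0 : ℝ) ≤ 7 / 11520 by norm_num)
      refine this.trans (le_of_eq ?_)
      push_cast; ring
    exact le_trans (mul_le_mul_of_nonneg_right key SC_pos.le) m2.2

/-- **Specification of `zetaEncl`.** For `s ∈ B` with `lo (Re B) ≥ 0`: the main terms lie in the
three boxes and the remainders are bounded by the three radii. [folklore] -/
theorem zetaEncl_spec {E : ZetaEncl} (h : zetaEncl B = some E) (hs : CB.mem s B)
    (h0 : 0 ≤ B.re.lo) :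
    CB.mem (emMain 6 s) E.M0 ∧ CB.mem (emMain₁ 6 s) E.M1 ∧ CB.mem (emMain₂ 6 s) E.M2 ∧
      ‖emRem₂ 6 s‖ * SC ≤ (E.R0 : ℝ) ∧ ‖emRem₂D 6 s‖ * SC ≤ (E.R1 : ℝ) ∧
        ‖emRem₂DD 6 s‖ * SC ≤ (E.R2 : ℝ) := by
  simp only [zetaEncl, Option.bind_eq_some_iff] at h
  obtain ⟨p2, h2, p3, h3, p4, h4, p5, h5, p6, h6, A, hA, A1, hA1, A2, hA2, h⟩ := h
  simp only [Option.some.injEq] at h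
  subst h
  · have m2 := mem_cpowNegBox (n := 2) (by norm_num) mem_LOG2 hs h2
    have m3 := mem_cpowNegBox (n := 3) (by norm_num) mem_LOG3 hs h3
    have m4 := mem_cpowNegBox (n := 4) (by norm_num) mem_LOG4 hs h4
    have m5 := mem_cpowNegBox (n := 5) (by norm_num) mem_LOG5 hs h5
    have m6 := mem_cpowNegBox (n := 6) (by norm_num) mem_LOG6 hs h6
    have mA := mem_emABox hA hs
    have mA1 := mem_emA₁Box hA1 hs
    have mA2 := mem_emA₂Box hA2 hs
    obtain ⟨r0, r1, r2⟩ := remRadii_spec hs h0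
    have one : CB.mem ((1 : ℕ) : ℂ) (CB.ofInt 1) := by simpa using CB.mem_ofInt 1
    refine ⟨?_, ?_, ?_, r0, r1, r2⟩
    · have := CB.mem_add (CB.mem_add (CB.mem_add (CB.mem_add (CB.mem_add one m2) m3) m4) m5)
        (CB.mem_mul m6 mA)
      convert this using 1
      rw [emMain, sum_Ico_one_six]
      push_cast
      simp
    · have := CB.mem_add (CB.mem_neg (CB.mem_add (CB.mem_add (CB.mem_add
        (CB.mem_mulFI m2 mem_LOG2) (CB.mem_mulFI m3 mem_LOG3)) (CB.mem_mulFI m4 mem_LOG4))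
        (CB.mem_mulFI m5 mem_LOG5)))
        (CB.mem_mul m6 (CB.mem_sub mA1 (CB.mem_mulFI mA mem_LOG6)))
      convert this using 1
      rw [emMain₁, sum_Ico_one_six]
      push_cast
      simp only [Real.log_one, Complex.ofReal_zero, zero_mul, zero_add, one_cpow]
      ring
    · have := CB.mem_add (CB.mem_add (CB.mem_add (CB.mem_add
        (CB.mem_mulFI m2 (FI.mem_sqr mem_LOG2)) (CB.mem_mulFI m3 (FI.mem_sqr mem_LOG3)))
        (CB.mem_mulFI m4 (FI.mem_sqr mem_LOG4))) (CB.mem_mulFI m5 (FI.mem_sqr mem_LOG5)))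
        (CB.mem_mul m6 (CB.mem_add (CB.mem_sub mA2 (CB.mem_mulInt (CB.mem_mulFI mA1 mem_LOG6) 2))
          (CB.mem_mulFI mA (FI.mem_sqr mem_LOG6))))
      convert this using 1
      rw [emMain₂, sum_Ico_one_six]
      push_cast
      simp only [Real.log_one, Complex.ofReal_zero, zero_mul, zero_add, zero_pow two_ne_zero]
      ring

/-- **`ζ(s)` from the enclosure data**: `ζ(s) = m + r`, `m ∈ M0`, `‖r‖ · 2^48 ≤ R0` (for `s ∈ B`,
`lo (Re B) ≥ 0`, `s ≠ 1`). [cite: Edwards1974, §6.4 eq. (1)] -/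
theorem zeta_mem {E : ZetaEncl} (h : zetaEncl B = some E) (hs : CB.mem s B) (h0 : 0 ≤ B.re.lo)
    (hs1 : s ≠ 1) :
    ∃ m r : ℂ, riemannZeta s = m + r ∧ CB.mem m E.M0 ∧ ‖r‖ * SC ≤ (E.R0 : ℝ) := by
  obtain ⟨hM, -, -, hR, -, -⟩ := zetaEncl_spec h hs h0
  have hre : -4 < s.re := by
    have := le_trans (show ((0 : ℤ) : ℝ) ≤ B.re.lo by exact_mod_cast h0) hs.1.1
    simp at this; nlinarith [SC_pos]
  exact ⟨_, _, riemannZeta_eq_emMain_add_emRem₂ (by norm_num) hre hs1, hM, hR⟩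

/-- **`ζ'(s)` from the enclosure data.** [cite: Edwards1974, §6.4 eq. (1)] -/
theorem deriv_zeta_mem {E : ZetaEncl} (h : zetaEncl B = some E) (hs : CB.mem s B)
    (h0 : 0 ≤ B.re.lo) (hs1 : s ≠ 1) :
    ∃ m r : ℂ, deriv riemannZeta s = m + r ∧ CB.mem m E.M1 ∧ ‖r‖ * SC ≤ (E.R1 : ℝ) := by
  obtain ⟨-, hM, -, -, hR, -⟩ := zetaEncl_spec h hs h0
  have hre : -4 < s.re := by
    have := le_trans (show ((0 : ℤ) : ℝ) ≤ B.re.lo by exact_mod_cast h0) hs.1.1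
    simp at this; nlinarith [SC_pos]
  exact ⟨_, _, deriv_riemannZeta_eq_eulerMaclaurin₂ (by norm_num) hre hs1, hM, hR⟩

/-- **`ζ''(s)` from the enclosure data.** [cite: Edwards1974, §6.4 eq. (1)] -/
theorem deriv2_zeta_mem {E : ZetaEncl} (h : zetaEncl B = some E) (hs : CB.mem s B)
    (h0 : 0 ≤ B.re.lo) (hs1 : s ≠ 1) :
    ∃ m r : ℂ, deriv (deriv riemannZeta) s = m + r ∧ CB.mem m E.M2 ∧
      ‖r‖ * SC ≤ (E.R2 : ℝ) := by
  obtain ⟨-, -, hM, -, -, hR⟩ := zetaEncl_spec h hs h0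
  have hre : -4 < s.re := by
    have := le_trans (show ((0 : ℤ) : ℝ) ≤ B.re.lo by exact_mod_cast h0) hs.1.1
    simp at this; nlinarith [SC_pos]
  exact ⟨_, _, deriv2_riemannZeta_eq_eulerMaclaurin₂ (by norm_num) hre hs1, hM, hR⟩


/-! ### Rotating boxes by the quadrant labels -/

/-- The box of `qrot d · z` for `z` in the box `V`. [folklore] -/
def qrotBox (d : Fin 4) (V : CB) : CB :=
  match d with
  | 0 => V
  | 1 => ⟨V.im, V.re.neg⟩
  | 2 => V.neg
  | 3 => V.mulI

/-- [folklore] -/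
lemma mem_qrotBox (d : Fin 4) {z : ℂ} {V : CB} (hz : CB.mem z V) :
    CB.mem (qrot d * z) (qrotBox d V) := by
  fin_cases d
  · simpa [qrot, qrotBox] using hz
  · simp only [qrot, qrotBox]
    refine ⟨?_, ?_⟩
    · simpa using hz.2
    · simpa using FI.mem_neg hz.1
  · simpa [qrot, qrotBox] using CB.mem_neg hz
  · have := CB.mem_mulI hz
    simpa [qrot, qrotBox, mul_comm] using this

/-- The function being certified: `ζ` for `k = 0`, `ζ'` otherwise. [folklore] -/
noncomputable def Fk (k : ℕ) : ℂ → ℂ := if k = 0 then riemannZeta else deriv riemannZeta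

/-! ### The piece test -/

/-- The test for one piece: `B₀` the (thin) box of the starting point, `B` the box of the piece,
`h ≥ 0` its scaled length, `vert` whether it is vertical, `d` its label, `k` the function.
[folklore] -/
def pieceCheck (k : ℕ) (vert : Bool) (B₀ B : CB) (h : ℤ) (d : Fin 4) : Bool :=
  match zetaEncl B₀, zetaEncl B with
  | some E₀, some E =>
      let V := if k = 0 then E₀.M0 else E₀.M1
      let R₀ := if k = 0 then E₀.R0 else E₀.R1
      let D := if k = 0 then E.M1 else E.M2
      let R₁ := if k = 0 then E.R1 else E.R2
      let D' := if vert then D.mulI else D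
      let A := (qrotBox d V).re.lo - R₀
      let Bv := (qrotBox d D').re.lo - R₁
      decide (0 ≤ B₀.re.lo) && decide (0 ≤ B.re.lo) &&
        (decide (B.re.hi < SC) || decide (0 < B.im.lo)) &&
        decide (0 ≤ h) && decide (0 < A + min 0 (h * Bv / SC))
  | _, _ => false

/-- The test along a horizontal edge at scaled height `y`, starting at scaled abscissa `x₀`.
[folklore] -/
def hEdgeCheck (k : ℕ) (y : ℤ) : ℤ → List (ℤ × Fin 4) → Bool
  | _, [] => true
  | x₀, (x₁, d) :: L =>
      pieceCheck k false ⟨⟨x₀, x₀⟩, ⟨y, y⟩⟩ ⟨⟨x₀, x₁⟩, ⟨y, y⟩⟩ (x₁ - x₀) d && hEdgeCheck k y x₁ L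

/-- The test along a vertical edge at scaled abscissa `x`, starting at scaled height `y₀`.
[folklore] -/
def vEdgeCheck (k : ℕ) (x : ℤ) : ℤ → List (ℤ × Fin 4) → Bool
  | _, [] => true
  | y₀, (y₁, d) :: L =>
      pieceCheck k true ⟨⟨x, x⟩, ⟨y₀, y₀⟩⟩ ⟨⟨x, x⟩, ⟨y₀, y₁⟩⟩ (y₁ - y₀) d && vEdgeCheck k x y₁ L

/-! ### Integer piece lists and their real counterparts -/

/-- A scaled piece list read in `ℝ`. [folklore] -/
noncomputable def realize (L : List (ℤ × Fin 4)) : List (ℝ × Fin 4) :=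
  L.map fun p ↦ ((p.1 : ℝ) / SC, p.2)

/-- Last endpoint (scaled). [folklore] -/
def lastZ (x₀ : ℤ) : List (ℤ × Fin 4) → ℤ
  | [] => x₀
  | (x₁, _) :: L => lastZ x₁ L

/-- Last label. [folklore] -/
def lastDirZ (d : Fin 4) : List (ℤ × Fin 4) → Fin 4
  | [] => d
  | (_, d') :: L => lastDirZ d' L

/-- Turn count. [folklore] -/
def turnsZ (d : Fin 4) : List (ℤ × Fin 4) → ℤ
  | [] => 0
  | (_, d') :: L => qturn d d' + turnsZ d' L

/-- [folklore] -/
lemma piecesLast_realize (x₀ : ℤ) :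
    ∀ L : List (ℤ × Fin 4), piecesLast ((x₀ : ℝ) / SC) (realize L) = ((lastZ x₀ L : ℤ) : ℝ) / SC
  | [] => rfl
  | (x₁, d) :: L => by simpa [realize, lastZ] using piecesLast_realize x₁ L

/-- [folklore] -/
lemma piecesLastDir_realize (d : Fin 4) :
    ∀ L : List (ℤ × Fin 4), piecesLastDir d (realize L) = lastDirZ d L
  | [] => rfl
  | (x₁, d') :: L => by simpa [realize, lastDirZ] using piecesLastDir_realize d' L

/-- [folklore] -/
lemma piecesTurns_realize (d : Fin 4) :
    ∀ L : List (ℤ × Fin 4), piecesTurns d (realize L) = turnsZ d L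
  | [] => rfl
  | (x₁, d') :: L => by simpa [realize, turnsZ] using piecesTurns_realize d' L

/-- [folklore] -/
lemma realize_cons (x : ℤ) (d : Fin 4) (L : List (ℤ × Fin 4)) :
    realize ((x, d) :: L) = (((x : ℝ) / SC, d)) :: realize L := rfl

/-! ### The mean-value inequality -/

/-- If `g` is differentiable on `[a,b]` with `g' ≥ Bv` there, `g(a) ≥ A` and
`A + min(0, (b-a) Bv) > 0`, then `g > 0` on `[a,b]`. [folklore] -/
theorem pos_of_deriv_bound {g g' : ℝ → ℝ} {a b A Bv : ℝ}
    (hderiv : ∀ x ∈ Icc a b, HasDerivAt g (g' x) x) (hA : A ≤ g a)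
    (hB : ∀ x ∈ Icc a b, Bv ≤ g' x) (hpos : 0 < A + min 0 ((b - a) * Bv)) :
    ∀ x ∈ Icc a b, 0 < g x := by
  intro x hx
  have hmin : min 0 ((b - a) * Bv) ≤ 0 := min_le_left _ _
  rcases eq_or_lt_of_le hx.1 with h | h
  · rw [← h]; linarith
  · -- mean value theorem on `[a, x]`
    have hcont : ContinuousOn g (Icc a x) := fun t ht ↦
      (hderiv t ⟨ht.1, ht.2.trans hx.2⟩).continuousAt.continuousWithinAt
    obtain ⟨ξ, hξ, hslope⟩ := exists_hasDerivAt_eq_slope g g' h hcont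
      (fun t ht ↦ hderiv t ⟨ht.1.le, ht.2.le.trans hx.2⟩)
    have hξB := hB ξ ⟨hξ.1.le, hξ.2.le.trans hx.2⟩
    have hgx : g x = g a + (x - a) * g' ξ := by
      rw [hslope]; field_simp; ring
    have hkey : min 0 ((b - a) * Bv) ≤ (x - a) * g' ξ := by
      rcases le_or_gt 0 Bv with hBv | hBv
      · exact (min_le_left _ _).trans (by nlinarith [hx.1])
      · refine (min_le_right _ _).trans ?_
        nlinarith [hx.1, hx.2]
    rw [hgx]
    linarith

/-! ### Analytic facts about `ζ` and `ζ'` used by the checker -/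

/-- `Fk k` is differentiable away from `1`, with derivative `Fk (k+1)`-style:
`deriv (Fk 0) = Fk 1 = ζ'` and `deriv (Fk 1) = ζ''`. [folklore] -/
lemma hasDerivAt_Fk {k : ℕ} (hk : k = 0 ∨ k = 1) {s : ℂ} (hs : s ≠ 1) :
    HasDerivAt (Fk k) (deriv (Fk k) s) s := by
  rcases hk with rfl | rfl
  · simp only [Fk, if_true]
    exact (differentiableAt_riemannZeta hs).hasDerivAt
  · simp only [Fk, one_ne_zero, if_false]
    exact (analyticOnNhd_deriv_riemannZeta s hs).differentiableAt.hasDerivAt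

/-- The value/derivative decomposition delivered by `zetaEncl` for `Fk k`: with
`E = zetaEncl B`, `s ∈ B`, `Re B ≥ 0`, `s ≠ 1`, the value `Fk k s` is `m + r` with `m` in the
`k`-th main box and `‖r‖ 2^48 ≤` the `k`-th radius, and likewise `deriv (Fk k) s` with the
`(k+1)`-st. [folklore] -/
lemma Fk_mem {k : ℕ} (hk : k = 0 ∨ k = 1) {B : CB} {E : ZetaEncl} (h : zetaEncl B = some E)
    {s : ℂ} (hs : CB.mem s B) (h0 : 0 ≤ B.re.lo) (hs1 : s ≠ 1) :
    (∃ m r : ℂ, Fk k s = m + r ∧ CB.mem m (if k = 0 then E.M0 else E.M1) ∧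
      ‖r‖ * SC ≤ ((if k = 0 then E.R0 else E.R1 : ℤ) : ℝ)) ∧
    (∃ m r : ℂ, deriv (Fk k) s = m + r ∧ CB.mem m (if k = 0 then E.M1 else E.M2) ∧
      ‖r‖ * SC ≤ ((if k = 0 then E.R1 else E.R2 : ℤ) : ℝ)) := by
  rcases hk with rfl | rfl
  · simp only [Fk, if_true]
    exact ⟨zeta_mem h hs h0 hs1, deriv_zeta_mem h hs h0 hs1⟩
  · simp only [Fk, one_ne_zero, if_false]
    exact ⟨deriv_zeta_mem h hs h0 hs1, deriv2_zeta_mem h hs h0 hs1⟩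

/-- Lower bound of `Re (qrot d · (m + r))` from a box of `m` and a radius of `r`. [folklore] -/
lemma re_qrot_lower {d : Fin 4} {m r : ℂ} {V : CB} {R : ℤ} (hm : CB.mem m V)
    (hr : ‖r‖ * SC ≤ (R : ℝ)) :
    (((qrotBox d V).re.lo - R : ℤ) : ℝ) / SC ≤ (qrot d * (m + r)).re := by
  have h1 := (mem_qrotBox d hm).1.1
  have h2 : -‖r‖ ≤ (qrot d * r).re := by
    have := Complex.abs_re_le_norm (qrot d * r)
    rw [norm_mul] at this
    have hq : ‖qrot d‖ = 1 := by fin_cases d <;> simp [qrot]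
    rw [hq, one_mul] at this
    linarith [neg_abs_le ((qrot d * r).re)]
  rw [div_le_iff₀ SC_pos, mul_add, Complex.add_re]
  push_cast
  nlinarith [SC_pos]

/-! ### Soundness of the piece test -/

/-- Unpacking a successful piece test. [folklore] -/
lemma pieceCheck_spec {k : ℕ} {vert : Bool} {B₀ B : CB} {h : ℤ} {d : Fin 4}
    (hc : pieceCheck k vert B₀ B h d = true) :
    ∃ E₀ E : ZetaEncl, zetaEncl B₀ = some E₀ ∧ zetaEncl B = some E ∧
      0 ≤ B₀.re.lo ∧ 0 ≤ B.re.lo ∧ (B.re.hi < SC ∨ 0 < B.im.lo) ∧ 0 ≤ h ∧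
      0 < ((qrotBox d (if k = 0 then E₀.M0 else E₀.M1)).re.lo - (if k = 0 then E₀.R0 else E₀.R1)) +
        min 0 (h * ((qrotBox d (if vert then (if k = 0 then E.M1 else E.M2).mulI else
          (if k = 0 then E.M1 else E.M2))).re.lo - (if k = 0 then E.R1 else E.R2)) / SC) := by
  unfold pieceCheck at hc
  split at hc
  · rename_i E₀ E hE₀ hE
    simp only [Bool.and_eq_true, Bool.or_eq_true, decide_eq_true_eq] at hc
    exact ⟨E₀, E, hE₀, hE, hc.1.1.1.1, hc.1.1.1.2, hc.1.1.2, hc.1.2, hc.2⟩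
  · simp at hc

/-- A point of a box with `hi (Re B) < 2^48` or `lo (Im B) > 0` is not the pole `1`. [folklore] -/
lemma ne_one_of_box {s : ℂ} {B : CB} (hs : CB.mem s B) (h : B.re.hi < SC ∨ 0 < B.im.lo) :
    s ≠ 1 := by
  rintro rfl
  rcases h with h | h
  · have := hs.1.2
    simp at this
    have h' : ((B.re.hi : ℤ) : ℝ) < SC := by exact_mod_cast h
    linarith
  · have := hs.2.1
    simp at this
    have h' : (0 : ℝ) < B.im.lo := by exact_mod_cast h
    linarith

/-- The scaled inequality of the test implies the real one. [folklore] -/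
lemma real_pos_of_check {A Bv h : ℤ} (hpos : 0 < A + min 0 (h * Bv / SC)) :
    0 < (A : ℝ) / SC + min 0 (((h : ℝ) / SC) * ((Bv : ℝ) / SC)) := by
  have hfl := fdiv_le_div (a := h * Bv) SCZ_pos
  push_cast at hfl
  have hposR : (0 : ℝ) < A + min 0 ((h * Bv / SC : ℤ) : ℝ) := by exact_mod_cast hpos
  set X : ℝ := (h : ℝ) * Bv / SC with hX
  have hmin : min (0 : ℝ) ((h * Bv / SC : ℤ) : ℝ) ≤ min 0 X := min_le_min le_rfl hfl
  have hAX : (0 : ℝ) < A + min 0 X := by linarith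
  have e : ((h : ℝ) / SC) * ((Bv : ℝ) / SC) = X / SC := by rw [hX]; field_simp
  rw [e]
  rcases le_or_gt 0 X with h0 | h0
  · rw [min_eq_left (div_nonneg h0 SC_pos.le)]
    rw [min_eq_left h0] at hAX
    simpa using div_pos hAX SC_pos
  · rw [min_eq_right (div_nonpos_of_nonpos_of_nonneg h0.le SC_pos.le)]
    rw [min_eq_right h0.le] at hAX
    rw [← add_div]
    exact div_pos hAX SC_pos

/-- **Horizontal pieces are sound.** [folklore] -/
theorem hpiece_sound {k : ℕ} (hk : k = 0 ∨ k = 1) {y x₀ x₁ : ℤ} {d : Fin 4}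
    (hc : pieceCheck k false ⟨⟨x₀, x₀⟩, ⟨y, y⟩⟩ ⟨⟨x₀, x₁⟩, ⟨y, y⟩⟩ (x₁ - x₀) d = true) :
    (x₀ : ℝ) / SC ≤ (x₁ : ℝ) / SC ∧
      ∀ x ∈ Icc ((x₀ : ℝ) / SC) ((x₁ : ℝ) / SC),
        0 < (qrot d * Fk k ((x : ℂ) + (((y : ℝ) / SC : ℝ) : ℂ) * I)).re := by
  obtain ⟨E₀, E, hE₀, hE, h00, h0, hne, hh, hpos⟩ := pieceCheck_spec hc
  simp only [Bool.false_eq_true, if_false] at hpos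
  have hle : (x₀ : ℝ) / SC ≤ (x₁ : ℝ) / SC := by
    apply div_le_div_of_nonneg_right _ SC_pos.le
    have : (0 : ℝ) ≤ ((x₁ - x₀ : ℤ) : ℝ) := by exact_mod_cast hh
    push_cast at this; linarith
  refine ⟨hle, ?_⟩
  set yr : ℝ := (y : ℝ) / SC with hyr
  have hyS : yr * SC = y := by rw [hyr, div_mul_cancel₀ _ SC_ne]
  -- box memberships
  have memB : ∀ x ∈ Icc ((x₀ : ℝ) / SC) ((x₁ : ℝ) / SC),
      CB.mem ((x : ℂ) + (yr : ℂ) * I) ⟨⟨x₀, x₁⟩, ⟨y, y⟩⟩ := by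
    intro x hx
    have h1 : (x₀ : ℝ) ≤ x * SC := by rw [← div_le_iff₀ SC_pos]; exact hx.1
    have h2 : x * SC ≤ x₁ := by rw [← le_div_iff₀ SC_pos]; exact hx.2
    refine ⟨⟨?_, ?_⟩, ⟨?_, ?_⟩⟩
    · simpa using h1
    · simpa using h2
    · simp [hyS]
    · simp [hyS]
  have memB₀ : CB.mem (((x₀ : ℝ) / SC : ℝ) + (yr : ℂ) * I) ⟨⟨x₀, x₀⟩, ⟨y, y⟩⟩ := by
    have h1 : (x₀ : ℝ) / SC * SC = x₀ := div_mul_cancel₀ _ SC_ne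
    refine ⟨⟨?_, ?_⟩, ⟨?_, ?_⟩⟩
    · simp [h1]
    · simp [h1]
    · simp [hyS]
    · simp [hyS]
  set f := Fk k with hf
  -- derivative along the edge
  have hne1 : ∀ x ∈ Icc ((x₀ : ℝ) / SC) ((x₁ : ℝ) / SC), (x : ℂ) + (yr : ℂ) * I ≠ 1 := fun x hx ↦
    ne_one_of_box (memB x hx) hne
  set g : ℝ → ℝ := fun x ↦ (qrot d * f (x + yr * I)).re with hg
  set g' : ℝ → ℝ := fun x ↦ (qrot d * deriv f (x + yr * I)).re with hg'
  have hderiv : ∀ x ∈ Icc ((x₀ : ℝ) / SC) ((x₁ : ℝ) / SC), HasDerivAt g (g' x) x := by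
    intro x hx
    have h1 : HasDerivAt (fun w : ℂ ↦ qrot d * f (w + yr * I)) (qrot d * deriv f (x + yr * I)) x := by
      have hF := hasDerivAt_Fk hk (hne1 x hx)
      have hinner : HasDerivAt (fun w : ℂ ↦ w + yr * I) 1 (x : ℂ) := (hasDerivAt_id _).add_const _
      have := (hF.comp (x : ℂ) hinner).const_mul (qrot d)
      simpa using this
    exact h1.real_of_complex
  -- the two bounds
  obtain ⟨⟨m, r, hmr, hm, hr⟩, -⟩ :=
    Fk_mem hk hE₀ memB₀ h00 (ne_one_of_box (memB _ ⟨le_rfl, hle⟩) hne)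
  have hA : ((((qrotBox d (if k = 0 then E₀.M0 else E₀.M1)).re.lo -
      (if k = 0 then E₀.R0 else E₀.R1) : ℤ) : ℝ) / SC) ≤ g ((x₀ : ℝ) / SC) := by
    simp only [hg, hf]
    rw [hmr]
    exact re_qrot_lower hm hr
  have hB : ∀ x ∈ Icc ((x₀ : ℝ) / SC) ((x₁ : ℝ) / SC),
      ((((qrotBox d (if k = 0 then E.M1 else E.M2)).re.lo - (if k = 0 then E.R1 else E.R2) : ℤ) : ℝ)
        / SC) ≤ g' x := by
    intro x hx
    obtain ⟨-, ⟨m', r', hmr', hm', hr'⟩⟩ := Fk_mem hk hE (memB x hx) h0 (hne1 x hx)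
    simp only [hg', hf]
    rw [hmr']
    exact re_qrot_lower hm' hr'
  have hposR := real_pos_of_check hpos
  have hx10 : (x₁ : ℝ) / SC - (x₀ : ℝ) / SC = ((x₁ - x₀ : ℤ) : ℝ) / SC := by push_cast; ring
  have key := pos_of_deriv_bound hderiv hA hB (by rw [hx10]; exact hposR)
  intro x hx
  exact key x hx

/-- **Vertical pieces are sound.** [folklore] -/
theorem vpiece_sound {k : ℕ} (hk : k = 0 ∨ k = 1) {x y₀ y₁ : ℤ} {d : Fin 4}
    (hc : pieceCheck k true ⟨⟨x, x⟩, ⟨y₀, y₀⟩⟩ ⟨⟨x, x⟩, ⟨y₀, y₁⟩⟩ (y₁ - y₀) d = true) :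
    (y₀ : ℝ) / SC ≤ (y₁ : ℝ) / SC ∧
      ∀ y ∈ Icc ((y₀ : ℝ) / SC) ((y₁ : ℝ) / SC),
        0 < (qrot d * Fk k ((((x : ℝ) / SC : ℝ) : ℂ) + (y : ℂ) * I)).re := by
  obtain ⟨E₀, E, hE₀, hE, h00, h0, hne, hh, hpos⟩ := pieceCheck_spec hc
  simp only [if_true] at hpos
  have hle : (y₀ : ℝ) / SC ≤ (y₁ : ℝ) / SC := by
    apply div_le_div_of_nonneg_right _ SC_pos.le
    have : (0 : ℝ) ≤ ((y₁ - y₀ : ℤ) : ℝ) := by exact_mod_cast hh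
    push_cast at this; linarith
  refine ⟨hle, ?_⟩
  set xr : ℝ := (x : ℝ) / SC with hxr
  have hxS : xr * SC = x := by rw [hxr, div_mul_cancel₀ _ SC_ne]
  have memB : ∀ y ∈ Icc ((y₀ : ℝ) / SC) ((y₁ : ℝ) / SC),
      CB.mem ((xr : ℂ) + (y : ℂ) * I) ⟨⟨x, x⟩, ⟨y₀, y₁⟩⟩ := by
    intro y hy
    have h1 : (y₀ : ℝ) ≤ y * SC := by rw [← div_le_iff₀ SC_pos]; exact hy.1
    have h2 : y * SC ≤ y₁ := by rw [← le_div_iff₀ SC_pos]; exact hy.2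
    refine ⟨⟨?_, ?_⟩, ⟨?_, ?_⟩⟩
    · simp [hxS]
    · simp [hxS]
    · simpa using h1
    · simpa using h2
  have memB₀ : CB.mem ((xr : ℂ) + (((y₀ : ℝ) / SC : ℝ) : ℂ) * I) ⟨⟨x, x⟩, ⟨y₀, y₀⟩⟩ := by
    have h1 : (y₀ : ℝ) / SC * SC = y₀ := div_mul_cancel₀ _ SC_ne
    refine ⟨⟨?_, ?_⟩, ⟨?_, ?_⟩⟩
    · simp [hxS]
    · simp [hxS]
    · simp [h1]
    · simp [h1]
  set f := Fk k with hf
  have hne1 : ∀ y ∈ Icc ((y₀ : ℝ) / SC) ((y₁ : ℝ) / SC), (xr : ℂ) + (y : ℂ) * I ≠ 1 := fun y hy ↦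
    ne_one_of_box (memB y hy) hne
  set g : ℝ → ℝ := fun y ↦ (qrot d * f (xr + y * I)).re with hg
  set g' : ℝ → ℝ := fun y ↦ (qrot d * (deriv f (xr + y * I) * I)).re with hg'
  have hderiv : ∀ y ∈ Icc ((y₀ : ℝ) / SC) ((y₁ : ℝ) / SC), HasDerivAt g (g' y) y := by
    intro y hy
    have h1 : HasDerivAt (fun w : ℂ ↦ qrot d * f (xr + w * I))
        (qrot d * (deriv f (xr + y * I) * I)) y := by
      have hF := hasDerivAt_Fk hk (hne1 y hy)
      have hinner : HasDerivAt (fun w : ℂ ↦ (xr : ℂ) + w * I) I (y : ℂ) := by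
        simpa using ((hasDerivAt_id (y : ℂ)).mul_const I).const_add (xr : ℂ)
      have := (hF.comp (y : ℂ) hinner).const_mul (qrot d)
      simpa using this
    exact h1.real_of_complex
  obtain ⟨⟨m, r, hmr, hm, hr⟩, -⟩ :=
    Fk_mem hk hE₀ memB₀ h00 (ne_one_of_box (memB _ ⟨le_rfl, hle⟩) hne)
  have hA : ((((qrotBox d (if k = 0 then E₀.M0 else E₀.M1)).re.lo -
      (if k = 0 then E₀.R0 else E₀.R1) : ℤ) : ℝ) / SC) ≤ g ((y₀ : ℝ) / SC) := by
    simp only [hg, hf]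
    rw [hmr]
    exact re_qrot_lower hm hr
  have hB : ∀ y ∈ Icc ((y₀ : ℝ) / SC) ((y₁ : ℝ) / SC),
      ((((qrotBox d ((if k = 0 then E.M1 else E.M2).mulI)).re.lo -
        (if k = 0 then E.R1 else E.R2) : ℤ) : ℝ) / SC) ≤ g' y := by
    intro y hy
    obtain ⟨-, ⟨m', r', hmr', hm', hr'⟩⟩ := Fk_mem hk hE (memB y hy) h0 (hne1 y hy)
    simp only [hg', hf]
    rw [hmr', add_mul]
    refine re_qrot_lower (CB.mem_mulI hm') ?_
    rw [norm_mul, Complex.norm_I, mul_one]; exact hr'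
  have hposR := real_pos_of_check hpos
  have hy10 : (y₁ : ℝ) / SC - (y₀ : ℝ) / SC = ((y₁ - y₀ : ℤ) : ℝ) / SC := by push_cast; ring
  have key := pos_of_deriv_bound hderiv hA hB (by rw [hy10]; exact hposR)
  intro y hy
  exact key y hy

/-! ### Edges -/

/-- **A checked horizontal edge is a valid piece list.** [folklore] -/
theorem hEdgeCheck_sound {k : ℕ} (hk : k = 0 ∨ k = 1) (y : ℤ) :
    ∀ (x₀ : ℤ) (L : List (ℤ × Fin 4)), hEdgeCheck k y x₀ L = true →
      HPieces (Fk k) ((y : ℝ) / SC) ((x₀ : ℝ) / SC) (realize L)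
  | _, [], _ => by simp [realize]
  | x₀, (x₁, d) :: L, h => by
    simp only [hEdgeCheck, Bool.and_eq_true] at h
    obtain ⟨h1, h2⟩ := hpiece_sound hk h.1
    rw [realize_cons, HPieces_cons]
    exact ⟨h1, h2, hEdgeCheck_sound hk y x₁ L h.2⟩

/-- **A checked vertical edge is a valid piece list.** [folklore] -/
theorem vEdgeCheck_sound {k : ℕ} (hk : k = 0 ∨ k = 1) (x : ℤ) :
    ∀ (y₀ : ℤ) (L : List (ℤ × Fin 4)), vEdgeCheck k x y₀ L = true →
      VPieces (Fk k) ((x : ℝ) / SC) ((y₀ : ℝ) / SC) (realize L)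
  | _, [], _ => by simp [realize]
  | y₀, (y₁, d) :: L, h => by
    simp only [vEdgeCheck, Bool.and_eq_true] at h
    obtain ⟨h1, h2⟩ := vpiece_sound hk h.1
    rw [realize_cons, VPieces_cons]
    exact ⟨h1, h2, vEdgeCheck_sound hk x y₁ L h.2⟩

/-! ### Certificates -/

/-- Half, scaled: `½ · 2^48`. [folklore] -/
def HALF : ℤ := 140737488355328

/-- [folklore] -/
lemma HALF_spec : ((HALF : ℤ) : ℝ) / SC = 1 / 2 := by norm_num [HALF, SC]

/-- A certificate for the rectangle `[0, ½] × [bot/2^48, top/2^48]`: for each edge the first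
piece's endpoint and label and the remaining pieces (scaled integers; bottom and top edges from
left to right, vertical edges upwards). [folklore] -/
structure Cert where
  /-- scaled height of the bottom edge -/
  bot : ℤ
  /-- scaled height of the top edge -/
  top : ℤ
  /-- bottom edge: first endpoint -/
  xB : ℤ
  /-- bottom edge: first label -/
  dB : Fin 4
  /-- bottom edge: remaining pieces -/
  LB : List (ℤ × Fin 4)
  /-- right edge -/
  yR : ℤ
  /-- right edge -/
  dR : Fin 4
  /-- right edge -/
  LR : List (ℤ × Fin 4)
  /-- top edge -/
  xT : ℤ
  /-- top edge -/
  dT : Fin 4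
  /-- top edge -/
  LT : List (ℤ × Fin 4)
  /-- left edge -/
  yL : ℤ
  /-- left edge -/
  dL : Fin 4
  /-- left edge -/
  LL : List (ℤ × Fin 4)

/-- The total turn count of a certificate (integer version of `certTurns`). [folklore] -/
def certTurnsZ (C : Cert) : ℤ :=
  turnsZ C.dB C.LB + qturn (lastDirZ C.dB C.LB) C.dR + turnsZ C.dR C.LR +
    qturn (lastDirZ C.dR C.LR) (lastDirZ C.dT C.LT) - turnsZ C.dT C.LT +
    qturn C.dT (lastDirZ C.dL C.LL) - turnsZ C.dL C.LL + qturn C.dL C.dB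

/-- **The complete test** of a certificate for `Fk k` on `[0, ½] × [bot, top]`. [folklore] -/
def certCheck (k : ℕ) (C : Cert) : Bool :=
  decide (C.bot < C.top) &&
  hEdgeCheck k C.bot 0 ((C.xB, C.dB) :: C.LB) && vEdgeCheck k HALF C.bot ((C.yR, C.dR) :: C.LR) &&
  hEdgeCheck k C.top 0 ((C.xT, C.dT) :: C.LT) && vEdgeCheck k 0 C.bot ((C.yL, C.dL) :: C.LL) &&
  decide (lastZ C.xB C.LB = HALF) && decide (lastZ C.yR C.LR = C.top) &&
  decide (lastZ C.xT C.LT = HALF) && decide (lastZ C.yL C.LL = C.top) &&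
  decide (certTurnsZ C = 0)

/-- **Soundness of the certificate test**: `Fk k` has no zero in the open rectangle
`(0, ½) × (bot/2^48, top/2^48)`, nor on its closed top edge. [folklore] -/
theorem Fk_ne_zero_of_certCheck {k : ℕ} (hk : k = 0 ∨ k = 1) {C : Cert}
    (h : certCheck k C = true) :
    (∀ z ∈ Ioo (0 : ℝ) (1 / 2) ×ℂ Ioo ((C.bot : ℝ) / SC) ((C.top : ℝ) / SC), Fk k z ≠ 0) ∧
      ∀ x ∈ Icc (0 : ℝ) (1 / 2), Fk k (x + (((C.top : ℝ) / SC : ℝ) : ℂ) * I) ≠ 0 := by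
  simp only [certCheck, Bool.and_eq_true, decide_eq_true_eq] at h
  obtain ⟨⟨⟨⟨⟨⟨⟨⟨⟨htop, hB⟩, hR⟩, hT⟩, hL⟩, eB⟩, eR⟩, eT⟩, eL⟩, hturns⟩ := h
  have hBs := hEdgeCheck_sound hk C.bot 0 _ hB
  have hRs := vEdgeCheck_sound hk HALF C.bot _ hR
  have hTs := hEdgeCheck_sound hk C.top 0 _ hT
  have hLs := vEdgeCheck_sound hk 0 C.bot _ hL
  rw [realize_cons] at hBs hRs hTs hLs
  simp only [Int.cast_zero, zero_div, HALF_spec] at hBs hRs hTs hLs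
  have hbt : (C.bot : ℝ) / SC < (C.top : ℝ) / SC :=
    div_lt_div_of_pos_right (by exact_mod_cast htop) SC_pos
  -- analyticity on the closed rectangle (it avoids `1`)
  have hne1 : ∀ z ∈ Icc (0 : ℝ) (1 / 2) ×ℂ Icc ((C.bot : ℝ) / SC) ((C.top : ℝ) / SC), z ≠ 1 := by
    rintro z ⟨⟨-, hz⟩, -⟩ rfl
    simp at hz
    linarith
  have hf : AnalyticOnNhd ℂ (Fk k) (Icc (0 : ℝ) (1 / 2) ×ℂ Icc ((C.bot : ℝ) / SC) ((C.top : ℝ) / SC)) := by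
    intro z hz
    rcases hk with rfl | rfl
    · simp only [Fk, if_true]; exact analyticOn_riemannZeta z (hne1 z hz)
    · simp only [Fk, one_ne_zero, if_false]; exact analyticOnNhd_deriv_riemannZeta z (hne1 z hz)
  refine ⟨no_zero_of_winding_certificate (by norm_num) hbt hf hBs ?_ hRs ?_ hTs ?_ hLs ?_ ?_, ?_⟩
  · rw [piecesLast_realize, eB, HALF_spec]
  · rw [piecesLast_realize, eR]
  · rw [piecesLast_realize, eT, HALF_spec]
  · rw [piecesLast_realize, eL]
  · simp only [certTurns, piecesTurns_realize, piecesLastDir_realize]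
    exact hturns
  · intro x hx
    refine hTs.ne_zero x ?_ (by simp)
    rw [piecesLast_cons, piecesLast_realize, eT, HALF_spec]
    exact hx

/-- **`ζ ≠ 0` on `(0,½) × (bot, top]` from a certificate** (scaled heights). [folklore] -/
theorem riemannZeta_ne_zero_of_certCheck {C : Cert} (h : certCheck 0 C = true) {s : ℂ}
    (h0 : 0 < s.re) (h1 : s.re < 1 / 2) (h2 : (C.bot : ℝ) / SC < s.im) (h3 : s.im ≤ (C.top : ℝ) / SC) :
    riemannZeta s ≠ 0 := by
  obtain ⟨hin, htop⟩ := Fk_ne_zero_of_certCheck (k := 0) (Or.inl rfl) h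
  simp only [Fk, if_true] at hin htop
  rcases h3.lt_or_eq with h3 | h3
  · exact hin s ⟨⟨h0, h1⟩, ⟨h2, h3⟩⟩
  · have hs : s = (s.re : ℂ) + (((C.top : ℝ) / SC : ℝ) : ℂ) * I := by
      rw [← h3]; exact (Complex.re_add_im s).symm
    rw [hs]
    exact htop s.re ⟨h0.le, h1.le⟩

/-- **`ζ' ≠ 0` on `(0,½) × (bot, top]` from a certificate** (scaled heights). [folklore] -/
theorem deriv_riemannZeta_ne_zero_of_certCheck {C : Cert} (h : certCheck 1 C = true) {s : ℂ}
    (h0 : 0 < s.re) (h1 : s.re < 1 / 2) (h2 : (C.bot : ℝ) / SC < s.im) (h3 : s.im ≤ (C.top : ℝ) / SC) :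
    deriv riemannZeta s ≠ 0 := by
  obtain ⟨hin, htop⟩ := Fk_ne_zero_of_certCheck (k := 1) (Or.inr rfl) h
  simp only [Fk, one_ne_zero, if_false] at hin htop
  rcases h3.lt_or_eq with h3 | h3
  · exact hin s ⟨⟨h0, h1⟩, ⟨h2, h3⟩⟩
  · have hs : s = (s.re : ℂ) + (((C.top : ℝ) / SC : ℝ) : ℂ) * I := by
      rw [← h3]; exact (Complex.re_add_im s).symm
    rw [hs]
    exact htop s.re ⟨h0.le, h1.le⟩

end Literature.NumberTheory.LFunctions.ZetaNum
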